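import Literature.AlgebraicGeometry.Motives.AbelianVarietyProduct
import HarnessLib

/-!
# Products of isogenies of abelian varieties

For homomorphisms `f : A₁ → B₁`, `g : A₂ → B₂` of abelian varieties over a field `k`, the product
`f × g : A₁ ×ₖ A₂ → B₁ ×ₖ B₂` (`AbelianVariety.prodMap`, the pairing of `fst ≫ f` and `snd ≫ g` in the
sense of `Motives/AbelianVarietyProduct`) has underlying morphism of schemes
`pullback.map` over `Spec k` (`toSchemeHom_prodMap`), and **is an isogeny when `f` and `g` are**
(`isIsogeny_prodMap`): an isogeny is a finite surjective homomorphism (`AbelianVariety.IsIsogeny`,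
Mumford §7 Application 3), and both `Surjective` and `IsFinite` are stable under base change and
composition, so they pass to `pullback.map` (Mathlib `MorphismProperty.pullbackMap`).  Hence the
tree's ordered isogeny relation `IsIsogenous A B` (an isogeny `A → B`) is compatible with binary
products (`IsIsogenous.prod`).  Everything here is proved; no named facts.  (Milne 1986 §12 p. 122:
«each abelian variety `A` is isogenous to a product `∏ A_i^{r_i}`» — the bookkeeping of isogenies
between products used there and in Shimura 1998 §5.1 Prop. 3.)

Mathlib searched: `MorphismProperty.pullbackMap`, instances `IsStableUnderBaseChange @Surjective`
(`Mathlib/AlgebraicGeometry/PullbackCarrier`), `IsStableUnderBaseChange @IsFinite`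
(`Mathlib/AlgebraicGeometry/Morphisms/Finite`) — used; Mathlib has no abelian varieties.

## References

* D. Mumford, *Abelian Varieties* (1970), §7 Application 3 (isogenies), §19 (homomorphisms of
  products). [MumfordAV1970]
* J. S. Milne, *Abelian Varieties*, in Cornell–Silverman, *Arithmetic Geometry* (1986), §12 p. 122
  (held copy `book:cornellnd-arithmetic-geometry`, PDF p. 189). [Milne1986AbelianVarieties]
-/

noncomputable section

universe u

open CategoryTheory CategoryTheory.Limits AlgebraicGeometry

namespace Literature.AlgebraicGeometry.Motives.AbelianVariety

variable {k : Type u} [Field k] {A₁ A₂ B₁ B₂ : AbelianVariety k}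

/-- The product `f × g : A₁ ×ₖ A₂ → B₁ ×ₖ B₂` of two homomorphisms of abelian varieties: the pairing
of `fst ≫ f` and `snd ≫ g` (Mumford §19, homomorphisms into a product). [folklore] -/
def prodMap (f : A₁ ⟶ B₁) (g : A₂ ⟶ B₂) : A₁.prod A₂ ⟶ B₁.prod B₂ :=
  prodLift (fst A₁ A₂ ≫ f) (snd A₁ A₂ ≫ g)

/-- `(f × g) ≫ fst = fst ≫ f`. [folklore] -/
@[reassoc (attr := simp)]
theorem prodMap_fst (f : A₁ ⟶ B₁) (g : A₂ ⟶ B₂) : prodMap f g ≫ fst B₁ B₂ = fst A₁ A₂ ≫ f :=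
  prodLift_fst _ _

/-- `(f × g) ≫ snd = snd ≫ g`. [folklore] -/
@[reassoc (attr := simp)]
theorem prodMap_snd (f : A₁ ⟶ B₁) (g : A₂ ⟶ B₂) : prodMap f g ≫ snd B₁ B₂ = snd A₁ A₂ ≫ g :=
  prodLift_snd _ _

/-- On underlying schemes `f × g` is `pullback.map` of the underlying morphisms over `Spec k`.
[folklore] -/
theorem toSchemeHom_prodMap (f : A₁ ⟶ B₁) (g : A₂ ⟶ B₂) :
    Hom.toSchemeHom (prodMap f g) =
      pullback.map A₁.X.hom A₂.X.hom B₁.X.hom B₂.X.hom (Hom.toSchemeHom f) (Hom.toSchemeHom g) (𝟙 _)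
        ((Category.comp_id _).trans (Over.w f.hom.hom.hom).symm)
        ((Category.comp_id _).trans (Over.w g.hom.hom.hom).symm) := by
  apply pullback.hom_ext
  · simp [prodMap, toSchemeHom_prodLift]
    rfl
  · simp [prodMap, toSchemeHom_prodLift]
    rfl

/-- **A product of isogenies is an isogeny**: `f × g` is surjective and finite when `f` and `g` are
(both properties are stable under base change and composition; Mathlib `MorphismProperty.pullbackMap`).
[cite: MumfordAV1970, §7 Application 3 (p. 63) and §19] -/
theorem isIsogeny_prodMap {f : A₁ ⟶ B₁} {g : A₂ ⟶ B₂} (hf : IsIsogeny f) (hg : IsIsogeny g) :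
    IsIsogeny (prodMap f g) := by
  obtain ⟨hf₁, hf₂⟩ := hf
  obtain ⟨hg₁, hg₂⟩ := hg
  constructor
  · rw [toSchemeHom_prodMap]
    exact MorphismProperty.pullbackMap (P := @Surjective) hf₁ hg₁
      (Over.w f.hom.hom.hom).symm (Over.w g.hom.hom.hom).symm
  · rw [toSchemeHom_prodMap]
    exact MorphismProperty.pullbackMap (P := @IsFinite) hf₂ hg₂
      (Over.w f.hom.hom.hom).symm (Over.w g.hom.hom.hom).symm

/-- Isogeny, in the tree's ordered sense `IsIsogenous A B` (an isogeny `A → B`), is compatible with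
binary products. [cite: Milne1986AbelianVarieties, §12 p. 122] -/
theorem IsIsogenous.prod (h₁ : IsIsogenous A₁ B₁) (h₂ : IsIsogenous A₂ B₂) :
    IsIsogenous (A₁.prod A₂) (B₁.prod B₂) := by
  obtain ⟨f, hf⟩ := h₁
  obtain ⟨g, hg⟩ := h₂
  exact ⟨prodMap f g, isIsogeny_prodMap hf hg⟩

end Literature.AlgebraicGeometry.Motives.AbelianVariety

end
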